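import Literature.NumberTheory.ComplexMultiplication.SharedOddCharacterDegenerate
import HarnessLib

/-!
# A common ABELIAN CM subfield forces degeneracy: nested abelian CM fields, cyclotomic fields of nested levels

Number-field dress of `NumberTheory/ComplexMultiplication/SharedOddCharacterDegenerate` (two CM fields `K_{i₀}`,
`K_{i₁}` through a common finite normal subfield `F ≤ ℂ` on which `Aut(ℂ)` acts through an ABELIAN group and which is not
totally real: every family of CM types with `Φ_{i₀}`, `Φ_{i₁}` NONDEGENERATE has non-additive rank and is DEGENERATE —
`rank Hg(∏ A_i) < Σ rank Hg(A_i)`, exceptional Hodge classes on some `∏_i A_i^{k_i}` by Murty–Hazama).  Here `F = ι(k)` for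
a CM field `k` (totally complex suffices) which is an ABELIAN extension of `ℚ` (Mathlib's `IsAbelianGalois`: Galois with
commutative group), embedded in `K_{i₀}` by `j₀` and in `K_{i₁}` by `j₁`:

* `normalClosure_le_range_of_normal`, `ringEquiv_comm_apply_of_abelian` — for `k` normal all complex embeddings have the
  image `ι(k)`, on which the automorphisms of `ℂ` commute when `Gal(k/ℚ)` is abelian;
* **`cmFamilyRank_add_card_lt_of_abelianCM_subfield`**, **`not_isNondegenerateFamily_of_abelianCM_subfield`** — the
  theorem of the title (e.g. `k = ℚ(ζ_5)` inside `ℚ(ζ_15)`, `ℚ(ζ_20)`, `ℚ(ζ_5, √−3)`; `k = ℚ(ζ_7)` inside `ℚ(ζ_21)`);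
* **`cmFamilyRank_add_card_lt_of_ringHom_of_abelian`**, **`not_isNondegenerateFamily_of_ringHom_of_abelian`**,
  **`not_isNondegenerateFamily_of_ringHom_of_isCyclotomicExtension`** — NESTED abelian CM fields `K_{i₀} ↪ K_{i₁}`
  (`k = K_{i₀}`): for nondegenerate CM abelian varieties `A₀`, `A₁` with CM by `ℚ(ζ_N) ⊆ ℚ(ζ_M)`, `N ∣ M` (e.g. simple
  factors of Fermat Jacobians of nested levels), some `A₀^a × A₁^b × ⋯` carries an exceptional Hodge class — the negative
  complement of the coprime-level independence theorem (`IndependentCMFieldsHodge.slotwiseIndependent_of_coprime_cyclotomic`).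

For an imaginary QUADRATIC `k` no nondegeneracy is needed (`SharedImaginaryQuadraticFamilies`); "abelian" cannot be
dropped (the reflex pair of a non-Galois quartic CM field shares its dihedral CM closure and is nondegenerate,
`DihedralReflexPairCMHodge`).  Everything is proved; no definition, no named fact, no `sorry`.

## References

* [Kubota1965] T. Kubota, *On the field extension by complex multiplication*, Trans. AMS 118 (1965), §4 Lemma 2.
* [Gordon1999HodgeAVSurvey] B. B. Gordon, *A survey of the Hodge conjecture for abelian varieties*, §3 Theorem (Imai,
  Murty) and proof; 7.5–7.7 (Murty, Hazama).
* [Shimura1998] G. Shimura, *Abelian Varieties with Complex Multiplication and Modular Functions*, §8.1, §18.2.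
-/

set_option autoImplicit false

noncomputable section

open scoped BigOperators
open NumberField NumberField.ComplexEmbedding Module IntermediateField

namespace Literature.NumberTheory.ComplexMultiplication

open Literature.AlgebraicGeometry.Motives (CMType)
open Literature.AlgebraicGeometry.Pohlmann1968

/-! ### Number-field dress: a common ABELIAN CM subfield; nested abelian CM fields -/

section AbelianSubfield

variable {I : Type} {K : I → Type} [∀ i, Field (K i)] [∀ i, NumberField (K i)] [∀ i, IsCMField (K i)] [Fintype I]
  [Nonempty I]
variable {k : Type} [Field k] [NumberField k]

omit [Fintype I] [Nonempty I] [∀ i, IsCMField (K i)] [∀ i, NumberField (K i)] in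
/-- For `k` NORMAL over `ℚ` every complex embedding has the same image: the Galois closure of `k` in `ℂ` is `ι(k)`
("all the conjugates of `k` coincide"). [cite: Shimura1998, §8.1] -/
theorem normalClosure_le_range_of_normal [Normal ℚ k] (ι : k →+* ℂ) :
    ((normalClosure ℚ k ℂ : IntermediateField ℚ ℂ) : Set ℂ) ⊆ Set.range ι := by
  intro x hx
  have hle : normalClosure ℚ k ℂ ≤ ι.toRatAlgHom.fieldRange := by
    rw [normalClosure_le_iff]
    intro f
    rintro _ ⟨y, rfl⟩
    obtain ⟨γ, hγ⟩ := exists_algEquiv_comp_eq ι (f : k →+* ℂ)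
    exact ⟨γ y, by change ι (γ y) = f y; exact hγ y⟩
  obtain ⟨y, hy⟩ := hle hx
  exact ⟨y, hy⟩

omit [Fintype I] [Nonempty I] [∀ i, IsCMField (K i)] [∀ i, NumberField (K i)] in
/-- On `ι(k)`, `k` an ABELIAN extension of `ℚ` (Galois with commutative group, Mathlib's `IsAbelianGalois`), the
automorphisms of `ℂ` commute: `τ τ' (ι y) = τ' τ (ι y)` (`τ ∘ ι = ι ∘ γ`, `τ' ∘ ι = ι ∘ γ'`, `γγ' = γ'γ`).
[cite: Shimura1998, §8.1] -/
theorem ringEquiv_comm_apply_of_abelian [IsAbelianGalois ℚ k] (ι : k →+* ℂ)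
    (τ τ' : ℂ ≃+* ℂ) (x : ℂ) (hx : x ∈ normalClosure ℚ k ℂ) : τ (τ' x) = τ' (τ x) := by
  obtain ⟨y, rfl⟩ := normalClosure_le_range_of_normal ι hx
  obtain ⟨γ, hγ⟩ := exists_algEquiv_comp_eq_smul ι τ
  obtain ⟨γ', hγ'⟩ := exists_algEquiv_comp_eq_smul ι τ'
  rw [hγ', hγ, hγ, hγ', ← AlgEquiv.mul_apply, ← AlgEquiv.mul_apply, mul_comm' γ γ']

omit [Fintype I] [Nonempty I] [∀ i, IsCMField (K i)] [∀ i, NumberField (K i)] in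
/-- A totally complex field is moved by complex conjugation: some `ι(y)` is not real. [folklore] -/
private theorem exists_conj_apply_ne [IsTotallyComplex k] (ι : k →+* ℂ) :
    ∃ x : ℂ, x ∈ normalClosure ℚ k ℂ ∧ starRingEnd ℂ x ≠ x := by
  by_contra h
  refine IsTotallyComplex.complexEmbedding_not_isReal ι (RingHom.ext fun y => ?_)
  show starRingEnd ℂ (ι y) = ι y
  by_contra hy
  exact h ⟨ι y, apply_mem_normalClosure (I := Unit) (K := fun _ => k) () ι y, hy⟩

/-- **A common ABELIAN CM subfield forces degeneracy.**  Let `k` be a CM field (totally complex suffices) which is an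
abelian extension of `ℚ` (Galois with commutative group), embedded in `K_{i₀}` and in `K_{i₁}` (`i₀ ≠ i₁`) by `j₀`, `j₁`.  Then every family `Φ`
of CM types with `Φ_{i₀}` and `Φ_{i₁}` NONDEGENERATE has non-additive rank and is DEGENERATE: some `∏_i A_i^{k_i}` of
realisations carries an exceptional Hodge class — e.g. `k = ℚ(ζ_5)` inside `ℚ(ζ_15)`, `ℚ(ζ_20)`, `ℚ(ζ_5, √−3)`; any two
cyclotomic fields of nested levels.  (For an imaginary quadratic `k` nondegeneracy is not needed:
`SharedImaginaryQuadraticFamilies`.) [cite: Gordon1999HodgeAVSurvey, §3 Theorem (proof) and 7.5–7.7]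
[cite: Kubota1965, §4 Lemma 2] -/
theorem cmFamilyRank_add_card_lt_of_abelianCM_subfield [IsAbelianGalois ℚ k] [IsTotallyComplex k]
    {i₀ i₁ : I} (h01 : i₀ ≠ i₁) (j₀ : k →+* K i₀) (j₁ : k →+* K i₁)
    (Φ : ∀ i, CMType (K i)) (hnd₀ : IsNondegenerate (Φ i₀)) (hnd₁ : IsNondegenerate (Φ i₁)) :
    CMAlgebra.cmFamilyRank Φ + Fintype.card I < (∑ i, cmTypeRank (Φ i)) + 1 ∧ ¬ CMAlgebra.IsNondegenerateFamily Φ := by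
  obtain ⟨φ₀⟩ : Nonempty (K i₀ →+* ℂ) := inferInstance
  obtain ⟨φ₁⟩ : Nonempty (K i₁ →+* ℂ) := inferInstance
  haveI : @Normal ℚ ↥(normalClosure ℚ k ℂ) _ _ (IntermediateField.algebra' _) :=
    normal_normalClosure_complex (I := Unit) (K := fun _ => k) ()
  refine cmFamilyRank_add_card_lt_of_common_subfield h01 Φ hnd₀ hnd₁ (normalClosure ℚ k ℂ)
    (fun τ τ' x hx => ringEquiv_comm_apply_of_abelian (φ₀.comp j₀) τ τ' x hx)
    (exists_conj_apply_ne (φ₀.comp j₀)) φ₀ φ₁ (fun x hx => ?_) (fun x hx => ?_)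
  · obtain ⟨y, rfl⟩ := normalClosure_le_range_of_normal (φ₀.comp j₀) hx
    exact ⟨j₀ y, rfl⟩
  · obtain ⟨y, rfl⟩ := normalClosure_le_range_of_normal (φ₁.comp j₁) hx
    exact ⟨j₁ y, rfl⟩

/-- **… the family is degenerate.** [cite: Gordon1999HodgeAVSurvey, 7.5–7.7] -/
theorem not_isNondegenerateFamily_of_abelianCM_subfield [IsAbelianGalois ℚ k] [IsTotallyComplex k]
    {i₀ i₁ : I} (h01 : i₀ ≠ i₁) (j₀ : k →+* K i₀) (j₁ : k →+* K i₁)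
    (Φ : ∀ i, CMType (K i)) (hnd₀ : IsNondegenerate (Φ i₀)) (hnd₁ : IsNondegenerate (Φ i₁)) :
    ¬ CMAlgebra.IsNondegenerateFamily Φ :=
  (cmFamilyRank_add_card_lt_of_abelianCM_subfield h01 j₀ j₁ Φ hnd₀ hnd₁).2

/-- **NESTED abelian CM fields**: if `K_{i₀}` is an abelian extension of `ℚ` and embeds into `K_{i₁}` (`i₀ ≠ i₁`; e.g.
`ℚ(ζ_N) ⊆ ℚ(ζ_M)` for `N ∣ M`, `N ≥ 3`), every family with `Φ_{i₀}`, `Φ_{i₁}` nondegenerate has non-additive rank and is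
degenerate: for nondegenerate CM abelian varieties `A₀`, `A₁` with CM by such fields some `A₀^a × A₁^b × ⋯` carries an
exceptional Hodge class — the negative complement of the coprime-level independence theorem.
[cite: Gordon1999HodgeAVSurvey, 7.5–7.7] [cite: Kubota1965, §4 Lemma 2] -/
theorem cmFamilyRank_add_card_lt_of_ringHom_of_abelian {i₀ i₁ : I} (h01 : i₀ ≠ i₁) [IsAbelianGalois ℚ (K i₀)]
    (e : K i₀ →+* K i₁) (Φ : ∀ i, CMType (K i)) (hnd₀ : IsNondegenerate (Φ i₀)) (hnd₁ : IsNondegenerate (Φ i₁)) :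
    CMAlgebra.cmFamilyRank Φ + Fintype.card I < (∑ i, cmTypeRank (Φ i)) + 1 ∧ ¬ CMAlgebra.IsNondegenerateFamily Φ :=
  cmFamilyRank_add_card_lt_of_abelianCM_subfield h01 (RingHom.id (K i₀)) e Φ hnd₀ hnd₁

/-- **… the family is degenerate** (nested abelian CM fields). [cite: Gordon1999HodgeAVSurvey, 7.5–7.7] -/
theorem not_isNondegenerateFamily_of_ringHom_of_abelian {i₀ i₁ : I} (h01 : i₀ ≠ i₁) [IsAbelianGalois ℚ (K i₀)]
    (e : K i₀ →+* K i₁) (Φ : ∀ i, CMType (K i)) (hnd₀ : IsNondegenerate (Φ i₀)) (hnd₁ : IsNondegenerate (Φ i₁)) :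
    ¬ CMAlgebra.IsNondegenerateFamily Φ :=
  (cmFamilyRank_add_card_lt_of_ringHom_of_abelian h01 e Φ hnd₀ hnd₁).2

/-- **Cyclotomic fields of NESTED levels**: `K_{i₀}` an `N`-th cyclotomic extension of `ℚ` (abelian:
`IsCyclotomicExtension.isAbelianGalois`) embedded in `K_{i₁}` — e.g. `ℚ(ζ_N) ⊆ ℚ(ζ_M)`, `N ∣ M`: every family with
`Φ_{i₀}`, `Φ_{i₁}` nondegenerate is degenerate (contrast: COPRIME levels act independently and the family is nondegenerate
iff its members are, `IndependentCMFieldsHodge.isNondegenerateFamily_iff_of_coprime_cyclotomic`).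
[cite: Gordon1999HodgeAVSurvey, 7.5–7.7] [cite: Kubota1965, §4 Lemma 2] -/
theorem not_isNondegenerateFamily_of_ringHom_of_isCyclotomicExtension {i₀ i₁ : I} (h01 : i₀ ≠ i₁) (N : ℕ)
    [NeZero N] [IsCyclotomicExtension {N} ℚ (K i₀)] (e : K i₀ →+* K i₁) (Φ : ∀ i, CMType (K i))
    (hnd₀ : IsNondegenerate (Φ i₀)) (hnd₁ : IsNondegenerate (Φ i₁)) :
    CMAlgebra.cmFamilyRank Φ + Fintype.card I < (∑ i, cmTypeRank (Φ i)) + 1 ∧ ¬ CMAlgebra.IsNondegenerateFamily Φ := by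
  haveI : IsAbelianGalois ℚ (K i₀) := IsCyclotomicExtension.isAbelianGalois {N} ℚ (K i₀)
  exact cmFamilyRank_add_card_lt_of_ringHom_of_abelian h01 e Φ hnd₀ hnd₁

end AbelianSubfield

end Literature.NumberTheory.ComplexMultiplication

end
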